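import Summits.QuantumFields.YangMills.Theorems.AllWindowsColdBoxBulkMidHarmonicMaxPrincipleFluxInvDefs
import Summits.QuantumFields.YangMills.Theorems.AllWindowsColdBoxBulkMidHarmonicMaxPrincipleFlux
import Summits.QuantumFields.YangMills.Theorems.AllWindowsColdBoxBulkMidFluxExtension
import Summits.QuantumFields.YangMills.Theorems.WeakCouplingRatesDirichletHodge

/-!
# LINE-18 «BulkMidWindowSU2» (crux ⟨stmt-QuantumFields-24006⟩): the GAUGE-INVARIANT flux maximum principle K3″
# `DirHarmonicMaxPrincipleFluxInv` HOLDS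

`dirHarmonicMaxPrincipleFluxInv_holds : DirHarmonicMaxPrincipleFluxInv` — for the temporal-gauge Dirichlet problem of the cold box
(`H ≥ 1`): if every fully pinned plaquette OF the enlarged box `Λ⁺ = dirCorner + {0,…,2H+2}⁴` has `(sCirc (glue ϑ 0) ·)² ≤ B`, then
the harmonic extension satisfies `F̄² ≤ c (1 + log H)⁴ B` on every plaquette of `Λ⁺`, `c = 1219² (1 + 5136 c₁)²` with `c₁` the K1
constant (✓`stub_kernelDipoleDecay`).  Proof:
* the shell plaquettes and the corner plaquettes of `Λ⁺` are fully pinned plaquettes of `Λ⁺`, so the datum-only field `glue ϑ 0`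
  has circulation `≤ √B` on them;
* the L^∞ extension lemma ✓`FluxExt.exists_fluxExtension` gives an edge function `A = glue ϑ 0` off the cold box with
  `|sCirc A| ≤ 1219 √B` on every plaquette of `Λ⁺`;
* the forest gauge ✓`exists_dirFree_curl_eq` turns `A − glue ϑ 0` (supported on the cold box) into admissible free values `s`
  with `sCirc (glue ϑ s) = sCirc A` on the plaquettes of `Λ⁺`;
* ✓`abs_dirBackground_le_abs_add_sum` (`F̄ = c − K·c` through any admissible competitor) and the K1 row sums
  ✓`sum_abs_boxDirProjKernel_le` conclude exactly as in ✓`stub_harmonicMaxPrincipleFlux`.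

HONEST LABEL: an UNREGISTERED internal obligation (K3″, the gauge-invariant form of stub S5/K3′) of a critic-passed DRAFT line on the
R2ξ″ RECORD-rung crux 24006 is proved; no registered stub, crux, rung or summit is proved here; the Yang–Mills mass gap is NOT
proved by this file.
-/

set_option autoImplicit false

noncomputable section

open Finset Function
open Literature.Probability.LatticeModels (Site halfOpenBox mem_halfOpenBox)
open Literature.MathematicalPhysics.QuantumFieldTheory
open Literature.MathematicalPhysics.QuantumFieldTheory.LatticeMaxwell
open Literature.MathematicalPhysics.QuantumFieldTheory.AxialGauge
open Summit.QuantumFields.YangMills.Theorems.WeakCouplingRates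

namespace Summit.QuantumFields.YangMills.Theorems.AllWindowsColdBoxBulkMidLine

variable {H : ℕ}

/-- The plaquette of `{0,…,2H+2}⁴` whose `dirCorner`-translate is the key `(z, a, b)` (`a < b`, `z ∈ Λ⁺`, `z_a, z_b ≤ 2H`). -/
theorem shift_mem_plaquettesIn {z : Site 4} {a b : Fin 4} (hab : a < b) (hz : ∀ m, -1 ≤ z m ∧ z m ≤ 2 * (H : ℤ) + 1)
    (hza : z a ≤ 2 * (H : ℤ)) (hzb : z b ≤ 2 * (H : ℤ)) :
    ((z - dirCorner, a, b) : Plaq 4) ∈ plaquettesIn (halfOpenBox 4 (2 * H + 3)) ∧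
      Plaq.shift dirCorner ((z - dirCorner, a, b) : Plaq 4) = (z, a, b) := by
  refine ⟨?_, by ext <;> simp [Plaq.shift]⟩
  rw [Plaq.mem_plaquettesIn]
  have hne : a ≠ b := hab.ne
  refine ⟨?_, hab, ?_, ?_, ?_⟩ <;> rw [mem_halfOpenBox] <;> intro m <;> have hzm := hz m
  · simp [dirCorner]; omega
  · by_cases hma : m = a
    · subst hma; simp [dirCorner]; omega
    · simp [dirCorner, hma]; omega
  · by_cases hmb : m = b
    · subst hmb; simp [dirCorner]; omega
    · simp [dirCorner, hmb]; omega
  · by_cases hma : m = a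
    · subst hma; simp [dirCorner, hne]; omega
    · by_cases hmb : m = b
      · subst hmb; simp [dirCorner, hma]; omega
      · simp [dirCorner, hma, hmb]; omega

/-- Plaquette keys of the enlarged box: from `q ∈ plaquettesIn {0,…,2H+2}⁴` to the coordinates of `Plaq.shift dirCorner q`. -/
theorem coords_of_mem_plaquettesIn {q : Plaq 4} (hq : q ∈ plaquettesIn (halfOpenBox 4 (2 * H + 3))) :
    (∀ m, -1 ≤ (Plaq.shift dirCorner q).1 m ∧ (Plaq.shift dirCorner q).1 m ≤ 2 * (H : ℤ) + 1) ∧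
      (Plaq.shift dirCorner q).1 q.2.1 ≤ 2 * (H : ℤ) ∧ (Plaq.shift dirCorner q).1 q.2.2 ≤ 2 * (H : ℤ) ∧ q.2.1 ≠ q.2.2 := by
  rw [Plaq.mem_plaquettesIn] at hq
  obtain ⟨h1, hlt, h2, h3, -⟩ := hq
  rw [mem_halfOpenBox] at h1 h2 h3
  refine ⟨fun m => ?_, ?_, ?_, hlt.ne⟩
  · have := h1 m; simp only [Plaq.shift_fst, Pi.add_apply, dirCorner]; omega
  · have := h2 q.2.1; simp only [Pi.add_apply, Pi.single_eq_same] at this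
    simp only [Plaq.shift_fst, Pi.add_apply, dirCorner]; omega
  · have := h3 q.2.2; simp only [Pi.add_apply, Pi.single_eq_same] at this
    simp only [Plaq.shift_fst, Pi.add_apply, dirCorner]; omega

/-- An edge one of whose endpoints has a coordinate `−1` or `> 2H` (or whose own coordinate is `2H`) is not a free Dirichlet edge. -/
theorem not_mem_dirFreeEdges_of_coord {x : Site 4} {i : Fin 4}
    (h : (∃ m, x m = -1 ∨ 2 * (H : ℤ) < x m) ∨ x i = 2 * (H : ℤ)) : (x, i) ∉ dirFreeEdges H := by
  refine not_mem_dirFreeEdges_of_not_mem fun hc => ?_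
  rw [mem_coldBoxEdges_iff] at hc
  rcases h with ⟨m, hm | hm⟩ | h
  · have := hc.1 m; omega
  · have := hc.1 m; omega
  · have := hc.2; omega

section Hyp

variable {ϑ : Literature.MathematicalPhysics.QuantumLattice.ZdEdge 4 → ℝ} {B : ℝ}
  (hB : ∀ q ∈ plaquettesIn (halfOpenBox 4 (2 * H + 3)),
    ((Plaq.shift dirCorner q).1, (Plaq.shift dirCorner q).2.1) ∉ dirFreeEdges H →
    ((Plaq.shift dirCorner q).1 + Pi.single (Plaq.shift dirCorner q).2.1 1, (Plaq.shift dirCorner q).2.2) ∉ dirFreeEdges H →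
    ((Plaq.shift dirCorner q).1 + Pi.single (Plaq.shift dirCorner q).2.2 1, (Plaq.shift dirCorner q).2.1) ∉ dirFreeEdges H →
    ((Plaq.shift dirCorner q).1, (Plaq.shift dirCorner q).2.2) ∉ dirFreeEdges H →
    (sCirc (LatticeMaxwell.glue (pin := fun e => e ∉ dirFreeEdges H) dirCorner (2 * H + 3) ϑ 0) (Plaq.shift dirCorner q)) ^ 2 ≤ B)
include hB

/-- Under the K3″ hypothesis: a plaquette `(z,a,b)` of the enlarged box all of whose edges are pinned has `|sCirc (glue ϑ 0)| ≤ √B`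
(either orientation). -/
theorem abs_sCirc_dirGlue0_le_sqrt {z : Site 4} {a b : Fin 4} (hab : a ≠ b) (hz : ∀ m, -1 ≤ z m ∧ z m ≤ 2 * (H : ℤ) + 1)
    (hza : z a ≤ 2 * (H : ℤ)) (hzb : z b ≤ 2 * (H : ℤ))
    (h1 : (z, a) ∉ dirFreeEdges H) (h2 : (z + Pi.single a 1, b) ∉ dirFreeEdges H)
    (h3 : (z + Pi.single b 1, a) ∉ dirFreeEdges H) (h4 : (z, b) ∉ dirFreeEdges H) :
    |sCirc (LatticeMaxwell.glue (pin := fun e => e ∉ dirFreeEdges H) dirCorner (2 * H + 3) ϑ 0) (z, a, b)| ≤ Real.sqrt B := by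
  rcases lt_or_gt_of_ne hab with hlt | hlt
  · obtain ⟨hq, hs⟩ := shift_mem_plaquettesIn hlt hz hza hzb
    have := hB _ hq
    rw [hs] at this
    exact Real.abs_le_sqrt (this h1 h2 h3 h4)
  · obtain ⟨hq, hs⟩ := shift_mem_plaquettesIn hlt hz hzb hza
    have := hB _ hq
    rw [hs] at this
    have hsq := this h4 h3 h2 h1
    have hanti : sCirc (LatticeMaxwell.glue (pin := fun e => e ∉ dirFreeEdges H) dirCorner (2 * H + 3) ϑ 0) (z, a, b) =
        -sCirc (LatticeMaxwell.glue (pin := fun e => e ∉ dirFreeEdges H) dirCorner (2 * H + 3) ϑ 0) (z, b, a) := by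
      simp only [sCirc]; ring
    rw [hanti, abs_neg]
    exact Real.abs_le_sqrt hsq

/-- Shell plaquettes are fully pinned: `|sCirc (glue ϑ 0) (z,a,b)| ≤ √B` when a coordinate `c ∉ {a,b}` of `z` is extremal. -/
theorem abs_sCirc_dirGlue0_shell_le {z : Site 4} {a b c : Fin 4} (hab : a ≠ b) (hca : c ≠ a) (hcb : c ≠ b)
    (hz : ∀ m, -1 ≤ z m ∧ z m ≤ 2 * (H : ℤ) + 1) (hza : z a ≤ 2 * (H : ℤ)) (hzb : z b ≤ 2 * (H : ℤ))
    (hzc : z c = -1 ∨ z c = 2 * (H : ℤ) + 1) :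
    |sCirc (LatticeMaxwell.glue (pin := fun e => e ∉ dirFreeEdges H) dirCorner (2 * H + 3) ϑ 0) (z, a, b)| ≤ Real.sqrt B := by
  have hc : ∀ w : Site 4, w c = z c → ∃ m, w m = -1 ∨ 2 * (H : ℤ) < w m :=
    fun w hw => ⟨c, by rcases hzc with h | h <;> omega⟩
  refine abs_sCirc_dirGlue0_le_sqrt hB hab hz hza hzb
    (not_mem_dirFreeEdges_of_coord (Or.inl (hc z rfl)))
    (not_mem_dirFreeEdges_of_coord (Or.inl (hc _ (by simp [hca.symm]))))
    (not_mem_dirFreeEdges_of_coord (Or.inl (hc _ (by simp [hcb.symm]))))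
    (not_mem_dirFreeEdges_of_coord (Or.inl (hc z rfl)))

/-- Corner plaquettes are fully pinned: `|sCirc (glue ϑ 0) (y,i,j)| ≤ √B` when `y_i, y_j ∈ {−1, 2H}`. -/
theorem abs_sCirc_dirGlue0_corner_le {y : Site 4} {i j : Fin 4} (hij : i ≠ j) (hyi : y i = -1 ∨ y i = 2 * (H : ℤ))
    (hyj : y j = -1 ∨ y j = 2 * (H : ℤ)) (hy : ∀ m, -1 ≤ y m ∧ y m ≤ 2 * (H : ℤ) + 1) :
    |sCirc (LatticeMaxwell.glue (pin := fun e => e ∉ dirFreeEdges H) dirCorner (2 * H + 3) ϑ 0) (y, i, j)| ≤ Real.sqrt B := by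
  refine abs_sCirc_dirGlue0_le_sqrt hB hij hy (by rcases hyi with h | h <;> omega) (by rcases hyj with h | h <;> omega)
    ?_ ?_ ?_ ?_
  · exact not_mem_dirFreeEdges_of_coord (by rcases hyi with h | h; exact Or.inl ⟨i, Or.inl h⟩; exact Or.inr h)
  · refine not_mem_dirFreeEdges_of_coord ?_
    rcases hyj with h | h
    · exact Or.inl ⟨j, Or.inl (by simp [hij, h])⟩
    · exact Or.inr (by simp [hij, h])
  · refine not_mem_dirFreeEdges_of_coord ?_
    rcases hyi with h | h
    · exact Or.inl ⟨i, Or.inl (by simp [hij.symm, h])⟩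
    · exact Or.inr (by simp [hij.symm, h])
  · exact not_mem_dirFreeEdges_of_coord (by rcases hyj with h | h; exact Or.inl ⟨j, Or.inl h⟩; exact Or.inr h)

omit hB in
/-- The K3″ hypothesis forces `0 ≤ B` (the bottom shell plaquette at the corner is fully pinned). -/
theorem nonneg_of_hypInv (hB' : ∀ q ∈ plaquettesIn (halfOpenBox 4 (2 * H + 3)),
    ((Plaq.shift dirCorner q).1, (Plaq.shift dirCorner q).2.1) ∉ dirFreeEdges H →
    ((Plaq.shift dirCorner q).1 + Pi.single (Plaq.shift dirCorner q).2.1 1, (Plaq.shift dirCorner q).2.2) ∉ dirFreeEdges H →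
    ((Plaq.shift dirCorner q).1 + Pi.single (Plaq.shift dirCorner q).2.2 1, (Plaq.shift dirCorner q).2.1) ∉ dirFreeEdges H →
    ((Plaq.shift dirCorner q).1, (Plaq.shift dirCorner q).2.2) ∉ dirFreeEdges H →
    (sCirc (LatticeMaxwell.glue (pin := fun e => e ∉ dirFreeEdges H) dirCorner (2 * H + 3) ϑ 0) (Plaq.shift dirCorner q)) ^ 2 ≤ B) :
    0 ≤ B := by
  have h := abs_sCirc_dirGlue0_shell_le hB' (z := dirCorner) (a := 0) (b := 1) (c := 2) (by decide) (by decide) (by decide)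
    (fun m => by simp [dirCorner]; omega) (by simp [dirCorner]; omega) (by simp [dirCorner]; omega) (Or.inl rfl)
  by_contra hneg
  push Not at hneg
  have : Real.sqrt B = 0 := Real.sqrt_eq_zero'.2 hneg.le
  rw [this] at h
  have h0 := abs_nonneg (sCirc (LatticeMaxwell.glue (pin := fun e => e ∉ dirFreeEdges H) dirCorner (2 * H + 3) ϑ 0) (dirCorner, 0, 1))
  -- `|x| ≤ 0` is consistent; derive the contradiction from the hypothesis at this plaquette directly
  obtain ⟨hq, hs⟩ := shift_mem_plaquettesIn (H := H) (z := dirCorner) (a := 0) (b := 1) (by decide)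
    (fun m => by simp [dirCorner]; omega) (by simp [dirCorner]; omega) (by simp [dirCorner]; omega)
  have hsq := hB' _ hq
  rw [hs] at hsq
  have hc : ∀ w : Site 4, w 2 = -1 → ∃ m, w m = -1 ∨ 2 * (H : ℤ) < w m := fun w hw => ⟨2, Or.inl hw⟩
  have := hsq (not_mem_dirFreeEdges_of_coord (Or.inl (hc _ rfl)))
    (not_mem_dirFreeEdges_of_coord (Or.inl (hc _ (by simp [dirCorner]))))
    (not_mem_dirFreeEdges_of_coord (Or.inl (hc _ (by simp [dirCorner]))))
    (not_mem_dirFreeEdges_of_coord (Or.inl (hc _ rfl)))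
  nlinarith [sq_nonneg (sCirc (LatticeMaxwell.glue (pin := fun e => e ∉ dirFreeEdges H) dirCorner (2 * H + 3) ϑ 0) (dirCorner, 0, 1))]

end Hyp

/-- **K3″ holds**: the gauge-invariant flux maximum principle for the harmonic extension of the temporal-gauge Dirichlet problem. -/
theorem dirHarmonicMaxPrincipleFluxInv_holds : DirHarmonicMaxPrincipleFluxInv := by
  obtain ⟨c₁, hc₁, hK1⟩ := stub_kernelDipoleDecay
  refine ⟨1219 ^ 2 * (1 + 5136 * c₁) ^ 2, by positivity, fun H hH ϑ B hB p hp => ?_⟩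
  have hH' : (1 : ℝ) ≤ H := by exact_mod_cast hH
  have hlog0 : 0 ≤ Real.log H := Real.log_nonneg hH'
  have hB0 : 0 ≤ B := nonneg_of_hypInv hB
  have hsq : 0 ≤ Real.sqrt B := Real.sqrt_nonneg B
  set G : Literature.MathematicalPhysics.QuantumLattice.ZdEdge 4 → ℝ :=
    LatticeMaxwell.glue (pin := fun e => e ∉ dirFreeEdges H) dirCorner (2 * H + 3) ϑ 0 with hGdef
  -- the L^∞ extension of the datum-only field
  obtain ⟨A, hAG, hAflux⟩ := FluxExt.exists_fluxExtension (H := H) hH (ϑ := G) (ε := Real.sqrt B) hsq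
    (fun z a b c hab hca hcb hz hza hzb hzc => abs_sCirc_dirGlue0_shell_le hB hab hca hcb hz hza hzb hzc)
    (fun y i j hij hyi hyj hy => abs_sCirc_dirGlue0_corner_le hB hij hyi hyj hy)
  -- the forest gauge: `A − G` is supported on the cold box
  set φ : Site 4 → Fin 4 → ℝ := fun x i => if (x, i) ∈ AxialGauge.boxEdges 4 (2 * H + 1) then A (x, i) - G (x, i) else 0 with hφdef
  have hφ : ∀ x i, φ x i ≠ 0 → (x, i) ∈ AxialGauge.boxEdges 4 (2 * H + 1) := by
    intro x i h; by_contra hE; exact h (by simp only [hφdef, if_neg hE])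
  obtain ⟨s, hs⟩ := exists_dirFree_curl_eq H φ hφ
  have hedge : ∀ e : Literature.MathematicalPhysics.QuantumLattice.ZdEdge 4, e ∈ boxEdgesAt dirCorner (2 * H + 3) →
      φ e.1 e.2 + G e = A e := by
    rintro ⟨x, i⟩ hb
    by_cases hE : (x, i) ∈ AxialGauge.boxEdges 4 (2 * H + 1)
    · simp only [hφdef, if_pos hE]; ring
    · simp only [hφdef, if_neg hE, zero_add]; exact (hAG _ hb hE).symm
  have hcirc : ∀ q ∈ plaquettesIn (halfOpenBox 4 (2 * H + 3)),
      sCirc (LatticeMaxwell.glue (pin := fun e => e ∉ dirFreeEdges H) dirCorner (2 * H + 3) ϑ s) (Plaq.shift dirCorner q) =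
        sCirc A (Plaq.shift dirCorner q) := by
    intro q hq
    obtain ⟨hz, hza, hzb, hne⟩ := coords_of_mem_plaquettesIn hq
    rw [sCirc_glue, hs, bterm]
    set z := (Plaq.shift dirCorner q).1 with hzdef
    have hb1 : (z, q.2.1) ∈ boxEdgesAt dirCorner (2 * H + 3) := mem_dirBlock_iff.2 ⟨hz, hza⟩
    have hb4 : (z, q.2.2) ∈ boxEdgesAt dirCorner (2 * H + 3) := mem_dirBlock_iff.2 ⟨hz, hzb⟩
    have hb2 : (z + Pi.single q.2.1 1, q.2.2) ∈ boxEdgesAt dirCorner (2 * H + 3) := by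
      refine mem_dirBlock_iff.2 ⟨fun m => ?_, by simpa [hne] using hzb⟩
      by_cases hm : m = q.2.1
      · subst hm; have := hz q.2.1; simp; constructor <;> omega
      · simp [hm]; exact hz m
    have hb3 : (z + Pi.single q.2.2 1, q.2.1) ∈ boxEdgesAt dirCorner (2 * H + 3) := by
      refine mem_dirBlock_iff.2 ⟨fun m => ?_, by simpa [hne.symm] using hza⟩
      by_cases hm : m = q.2.2
      · subst hm; have := hz q.2.2; simp; constructor <;> omega
      · simp [hm]; exact hz m
    have e1 := hedge _ hb1; have e2 := hedge _ hb2; have e3 := hedge _ hb3; have e4 := hedge _ hb4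
    simp only [sCirc, LatticeForm.d₁, LatticeForm.e, Plaq.shift_snd, ← hzdef] at e1 e2 e3 e4 ⊢
    linarith
  have hsA : ∀ q ∈ plaquettesIn (halfOpenBox 4 (2 * H + 3)),
      |sCirc (LatticeMaxwell.glue (pin := fun e => e ∉ dirFreeEdges H) dirCorner (2 * H + 3) ϑ s) (Plaq.shift dirCorner q)| ≤
        1219 * Real.sqrt B := by
    intro q hq
    obtain ⟨hz, hza, hzb, hne⟩ := coords_of_mem_plaquettesIn hq
    rw [hcirc q hq]
    have := hAflux (Plaq.shift dirCorner q).1 q.2.1 q.2.2 hne hz hza hzb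
    simpa [Plaq.shift] using this
  -- `|F̄_p| ≤ |c_p| + Σ_q |K| |c|`
  have h1 := abs_dirBackground_le_abs_add_sum H ϑ s (Plaq.shift dirCorner p)
  have hrow := sum_abs_boxDirProjKernel_le hc₁.le (hK1 H hH) hH (Plaq.shift dirCorner p)
  have hlog : Real.log ((((2 * H + 2 : ℕ)) : ℝ) + 1) ≤ 4 + Real.log H := by
    have hH0 : (0 : ℝ) < H := by linarith
    have h5 : Real.log 5 ≤ 4 := by
      have := Real.log_le_sub_one_of_pos (by norm_num : (0 : ℝ) < 5); linarith
    calc Real.log ((((2 * H + 2 : ℕ)) : ℝ) + 1) ≤ Real.log (5 * H) := by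
          apply Real.log_le_log (by positivity); push_cast; linarith
      _ = Real.log 5 + Real.log H := Real.log_mul (by norm_num) hH0.ne'
      _ ≤ 4 + Real.log H := by linarith
  have hrow' : ∑ q ∈ plaquettesIn (halfOpenBox 4 (2 * H + 3)), |boxDirProjKernel H (Plaq.shift dirCorner p) (Plaq.shift dirCorner q)| ≤
      5136 * c₁ * (1 + Real.log H) ^ 2 := by
    refine hrow.trans ?_
    have : 16 * (1 + 80 * Real.log ((((2 * H + 2 : ℕ)) : ℝ) + 1)) ≤ 5136 * (1 + Real.log H) := by nlinarith
    calc c₁ * (1 + Real.log H) * (16 * (1 + 80 * Real.log ((((2 * H + 2 : ℕ)) : ℝ) + 1)))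
        ≤ c₁ * (1 + Real.log H) * (5136 * (1 + Real.log H)) := mul_le_mul_of_nonneg_left this (by positivity)
      _ = 5136 * c₁ * (1 + Real.log H) ^ 2 := by ring
  have h2 : ∑ q ∈ plaquettesIn (halfOpenBox 4 (2 * H + 3)),
      |boxDirProjKernel H (Plaq.shift dirCorner p) (Plaq.shift dirCorner q)| *
        |sCirc (LatticeMaxwell.glue (pin := fun e => e ∉ dirFreeEdges H) dirCorner (2 * H + 3) ϑ s) (Plaq.shift dirCorner q)| ≤
      (5136 * c₁ * (1 + Real.log H) ^ 2) * (1219 * Real.sqrt B) := by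
    calc _ ≤ ∑ q ∈ plaquettesIn (halfOpenBox 4 (2 * H + 3)),
          |boxDirProjKernel H (Plaq.shift dirCorner p) (Plaq.shift dirCorner q)| * (1219 * Real.sqrt B) :=
          Finset.sum_le_sum fun q hq => mul_le_mul_of_nonneg_left (hsA q hq) (abs_nonneg _)
      _ = (∑ q ∈ plaquettesIn (halfOpenBox 4 (2 * H + 3)), |boxDirProjKernel H (Plaq.shift dirCorner p) (Plaq.shift dirCorner q)|) *
          (1219 * Real.sqrt B) := by rw [Finset.sum_mul]
      _ ≤ (5136 * c₁ * (1 + Real.log H) ^ 2) * (1219 * Real.sqrt B) := mul_le_mul_of_nonneg_right hrow' (by positivity)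
  have h3 : |sCirc (LatticeMaxwell.glue (pin := fun e => e ∉ dirFreeEdges H) dirCorner (2 * H + 3) ϑ
      (mean (fun e => e ∉ dirFreeEdges H) dirCorner (2 * H + 3) ϑ)) (Plaq.shift dirCorner p)| ≤
      1219 * Real.sqrt B * ((1 + 5136 * c₁) * (1 + Real.log H) ^ 2) := by
    have hsp := hsA p hp
    have hsq1 : (1 : ℝ) ≤ (1 + Real.log H) ^ 2 := by nlinarith
    nlinarith [h1, h2, hsp, hsq, hc₁.le]
  have hM : 0 ≤ 1219 * Real.sqrt B * ((1 + 5136 * c₁) * (1 + Real.log H) ^ 2) := by positivity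
  have h4 := pow_le_pow_left₀ (abs_nonneg _) h3 2
  rw [sq_abs] at h4
  refine h4.trans (le_of_eq ?_)
  rw [show (1219 * Real.sqrt B * ((1 + 5136 * c₁) * (1 + Real.log H) ^ 2)) ^ 2 =
      1219 ^ 2 * (1 + 5136 * c₁) ^ 2 * (1 + Real.log H) ^ 4 * Real.sqrt B ^ 2 by ring, Real.sq_sqrt hB0]

end Summit.QuantumFields.YangMills.Theorems.AllWindowsColdBoxBulkMidLine

end
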